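import Mathlib
import Summits.Ventures.PercRepro2.V2SP
import Summits.Ventures.PercRepro2.Tail2DCount
import Summits.Ventures.PercRepro2.Tail2DThreePoint
import Summits.Ventures.PercRepro2.Tail2DP2Series
import Summits.Ventures.PercRepro2.Tail2DDisjointPaths

/-!
# Three disjoint red paths are rarer than two disjoint red paths together with a blue path (seat mine-b, cell pub-perc-repro2)

For every pattern `s` of the cell's series–parallel grammar, uniformly two-coloured,

  `#{r ≥ 3} ≤ #{r ≥ 2 ∧ b ≥ 1}`   (`disjoint3_le_conn2`),

the second member (`k = 2`) of the family `#{r ≥ k+1} ≤ #{r ≥ k ∧ b ≥ 1}` whose first member is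
`disjoint_le_conn` (registry §34.16: anti-diagonal unimodality of the two-colour tail,
`T(k+1, 0) ≤ T(k, 1)`).

PROOF by induction over the grammar. On an atom the left side is `0`. Under series both sides
multiply (`min(r₁, r₂) ≥ 3` iff both; `min(r) ≥ 2 ∧ min(b) ≥ 1` iff both factors satisfy it). Under
parallel, with `P = #{r = 0}`, `Q = #{r = 1}`, `Q₂ = #{r = 2}`, `Z = #{r = b = 0}`,
`W = #{r = 1, b = 0}` of the factors, `#{r ≥ 3} = MM' − PP' − QP' − PQ' − Q₂P' − QQ' − PQ₂'` and
`#{r ≥ 2 ∧ b ≥ 1} = MM' − PP' − QP' − PQ' − #{b=0}#{b'=0} + ZZ' + WZ' + ZW'`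
(inclusion–exclusion on `{r ≤ 1} ∪ {b = 0}`; `#{b = 0} = P` by the colour swap); the induction
hypothesis of a factor is the dual form `P ≤ Q₂ + Z + W`, and

  `PP' ≤ (Q₂ + Z + W)P' ≤ Q₂P' + (Z + W)(Q₂' + Z' + W') ≤ Q₂P' + PQ₂' + ZZ' + WZ' + ZW' + QQ'`

using `Z + W = #{r ≤ 1, b = 0} ≤ #{b = 0} = P` and `W ≤ Q`. The inequality is tight on the
degenerate pin laws.
-/

namespace Summit.Ventures.PercRepro2.Tail2D

open V2Closure

section Counts

variable (s : V2Closure.SP)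

/-- `#{r ≥ 3} + #{r = 0} + #{r = 1} + #{r = 2} = #Conf` -/
lemma card_r3_add :
    (Finset.univ.filter (fun y : s.Conf => 3 ≤ s.rLab y)).card + (Finset.univ.filter (fun y : s.Conf => s.rLab y = 0)).card
      + (Finset.univ.filter (fun y : s.Conf => s.rLab y = 1)).card + (Finset.univ.filter (fun y : s.Conf => s.rLab y = 2)).card
      = Fintype.card s.Conf := by
  rw [Finset.card_filter, Finset.card_filter, Finset.card_filter, Finset.card_filter, ← Finset.card_univ,
    Finset.card_eq_sum_ones, ← Finset.sum_add_distrib, ← Finset.sum_add_distrib, ← Finset.sum_add_distrib]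
  refine Finset.sum_congr rfl (fun y _ => ?_)
  split_ifs <;> omega

/-- `#{r ≥ 2 ∧ b ≥ 1} + #{r = 0} + #{r = 1} + #{b = 0} = #Conf + #{r = b = 0} + #{r = 1 ∧ b = 0}` -/
lemma card_c2_add :
    (Finset.univ.filter (fun y : s.Conf => 2 ≤ s.rLab y ∧ 1 ≤ s.bLab y)).card + (Finset.univ.filter (fun y : s.Conf => s.rLab y = 0)).card
      + (Finset.univ.filter (fun y : s.Conf => s.rLab y = 1)).card + (Finset.univ.filter (fun y : s.Conf => s.bLab y = 0)).card
      = Fintype.card s.Conf + (Finset.univ.filter (fun y : s.Conf => s.rLab y = 0 ∧ s.bLab y = 0)).card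
        + (Finset.univ.filter (fun y : s.Conf => s.rLab y = 1 ∧ s.bLab y = 0)).card := by
  rw [Finset.card_filter, Finset.card_filter, Finset.card_filter, Finset.card_filter, Finset.card_filter, Finset.card_filter,
    ← Finset.card_univ, Finset.card_eq_sum_ones, ← Finset.sum_add_distrib, ← Finset.sum_add_distrib, ← Finset.sum_add_distrib,
    ← Finset.sum_add_distrib, ← Finset.sum_add_distrib]
  refine Finset.sum_congr rfl (fun y _ => ?_)
  split_ifs <;> omega

/-- `#{r = b = 0} + #{r = 1 ∧ b = 0} ≤ #{b = 0}` -/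
lemma card_zw_le :
    (Finset.univ.filter (fun y : s.Conf => s.rLab y = 0 ∧ s.bLab y = 0)).card
      + (Finset.univ.filter (fun y : s.Conf => s.rLab y = 1 ∧ s.bLab y = 0)).card
      ≤ (Finset.univ.filter (fun y : s.Conf => s.bLab y = 0)).card := by
  rw [Finset.card_filter, Finset.card_filter, Finset.card_filter, ← Finset.sum_add_distrib]
  refine Finset.sum_le_sum (fun y _ => ?_)
  split_ifs <;> omega

/-- `#{r = 1 ∧ b = 0} ≤ #{r = 1}` -/
lemma card_w_le :
    (Finset.univ.filter (fun y : s.Conf => s.rLab y = 1 ∧ s.bLab y = 0)).card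
      ≤ (Finset.univ.filter (fun y : s.Conf => s.rLab y = 1)).card :=
  Finset.card_le_card (fun y hy => by simp only [Finset.mem_filter] at hy ⊢; exact ⟨hy.1, hy.2.1⟩)

end Counts

section Product

variable (s t : V2Closure.SP)

/-- series: `#{r ≥ 3}` multiplies -/
lemma card_r3_ser :
    (Finset.univ.filter (fun y : (V2Closure.SP.ser s t).Conf => 3 ≤ (V2Closure.SP.ser s t).rLab y)).card
      = (Finset.univ.filter (fun y : s.Conf => 3 ≤ s.rLab y)).card * (Finset.univ.filter (fun y : t.Conf => 3 ≤ t.rLab y)).card := by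
  simp only [Finset.card_filter]
  rw [← sum_prod_ite s t (fun a => 3 ≤ s.rLab a) (fun b => 3 ≤ t.rLab b)]
  refine Finset.sum_congr rfl (fun y _ => ?_)
  simp only [SP.rLab, serR]
  split_ifs <;> omega

/-- series: `#{r ≥ 2 ∧ b ≥ 1}` multiplies -/
lemma card_c2_ser :
    (Finset.univ.filter (fun y : (V2Closure.SP.ser s t).Conf => 2 ≤ (V2Closure.SP.ser s t).rLab y ∧ 1 ≤ (V2Closure.SP.ser s t).bLab y)).card
      = (Finset.univ.filter (fun y : s.Conf => 2 ≤ s.rLab y ∧ 1 ≤ s.bLab y)).card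
        * (Finset.univ.filter (fun y : t.Conf => 2 ≤ t.rLab y ∧ 1 ≤ t.bLab y)).card := by
  simp only [Finset.card_filter]
  rw [← sum_prod_ite s t (fun a => 2 ≤ s.rLab a ∧ 1 ≤ s.bLab a) (fun b => 2 ≤ t.rLab b ∧ 1 ≤ t.bLab b)]
  refine Finset.sum_congr rfl (fun y _ => ?_)
  simp only [SP.rLab, SP.bLab, serR, serB]
  split_ifs <;> omega

/-- parallel: `#{r ≥ 3} + PP' + QP' + PQ' + Q₂P' + QQ' + PQ₂' = MM'` -/
lemma card_r3_par :
    (Finset.univ.filter (fun y : (V2Closure.SP.par s t).Conf => 3 ≤ (V2Closure.SP.par s t).rLab y)).card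
      + (Finset.univ.filter (fun y : s.Conf => s.rLab y = 0)).card * (Finset.univ.filter (fun y : t.Conf => t.rLab y = 0)).card
      + (Finset.univ.filter (fun y : s.Conf => s.rLab y = 1)).card * (Finset.univ.filter (fun y : t.Conf => t.rLab y = 0)).card
      + (Finset.univ.filter (fun y : s.Conf => s.rLab y = 0)).card * (Finset.univ.filter (fun y : t.Conf => t.rLab y = 1)).card
      + (Finset.univ.filter (fun y : s.Conf => s.rLab y = 2)).card * (Finset.univ.filter (fun y : t.Conf => t.rLab y = 0)).card
      + (Finset.univ.filter (fun y : s.Conf => s.rLab y = 1)).card * (Finset.univ.filter (fun y : t.Conf => t.rLab y = 1)).card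
      + (Finset.univ.filter (fun y : s.Conf => s.rLab y = 0)).card * (Finset.univ.filter (fun y : t.Conf => t.rLab y = 2)).card
      = Fintype.card s.Conf * Fintype.card t.Conf := by
  simp only [Finset.card_filter]
  rw [← sum_prod_ite s t (fun a => s.rLab a = 0) (fun b => t.rLab b = 0), ← sum_prod_ite s t (fun a => s.rLab a = 1) (fun b => t.rLab b = 0),
    ← sum_prod_ite s t (fun a => s.rLab a = 0) (fun b => t.rLab b = 1), ← sum_prod_ite s t (fun a => s.rLab a = 2) (fun b => t.rLab b = 0),
    ← sum_prod_ite s t (fun a => s.rLab a = 1) (fun b => t.rLab b = 1), ← sum_prod_ite s t (fun a => s.rLab a = 0) (fun b => t.rLab b = 2),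
    ← Fintype.card_prod, ← Finset.card_univ, Finset.card_eq_sum_ones]
  change (∑ y : s.Conf × t.Conf, if 3 ≤ s.rLab y.1 + t.rLab y.2 then 1 else 0) + _ + _ + _ + _ + _ + _ = _
  rw [← Finset.sum_add_distrib, ← Finset.sum_add_distrib, ← Finset.sum_add_distrib, ← Finset.sum_add_distrib,
    ← Finset.sum_add_distrib, ← Finset.sum_add_distrib]
  refine Finset.sum_congr rfl (fun y _ => ?_)
  split_ifs <;> omega

/-- parallel: `#{r ≥ 2 ∧ b ≥ 1} + PP' + QP' + PQ' + B₀B₀' = MM' + ZZ' + WZ' + ZW'` -/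
lemma card_c2_par :
    (Finset.univ.filter (fun y : (V2Closure.SP.par s t).Conf =>
        2 ≤ (V2Closure.SP.par s t).rLab y ∧ 1 ≤ (V2Closure.SP.par s t).bLab y)).card
      + (Finset.univ.filter (fun y : s.Conf => s.rLab y = 0)).card * (Finset.univ.filter (fun y : t.Conf => t.rLab y = 0)).card
      + (Finset.univ.filter (fun y : s.Conf => s.rLab y = 1)).card * (Finset.univ.filter (fun y : t.Conf => t.rLab y = 0)).card
      + (Finset.univ.filter (fun y : s.Conf => s.rLab y = 0)).card * (Finset.univ.filter (fun y : t.Conf => t.rLab y = 1)).card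
      + (Finset.univ.filter (fun y : s.Conf => s.bLab y = 0)).card * (Finset.univ.filter (fun y : t.Conf => t.bLab y = 0)).card
      = Fintype.card s.Conf * Fintype.card t.Conf
        + (Finset.univ.filter (fun y : s.Conf => s.rLab y = 0 ∧ s.bLab y = 0)).card
          * (Finset.univ.filter (fun y : t.Conf => t.rLab y = 0 ∧ t.bLab y = 0)).card
        + (Finset.univ.filter (fun y : s.Conf => s.rLab y = 1 ∧ s.bLab y = 0)).card
          * (Finset.univ.filter (fun y : t.Conf => t.rLab y = 0 ∧ t.bLab y = 0)).card
        + (Finset.univ.filter (fun y : s.Conf => s.rLab y = 0 ∧ s.bLab y = 0)).card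
          * (Finset.univ.filter (fun y : t.Conf => t.rLab y = 1 ∧ t.bLab y = 0)).card := by
  simp only [Finset.card_filter]
  rw [← sum_prod_ite s t (fun a => s.rLab a = 0) (fun b => t.rLab b = 0), ← sum_prod_ite s t (fun a => s.rLab a = 1) (fun b => t.rLab b = 0),
    ← sum_prod_ite s t (fun a => s.rLab a = 0) (fun b => t.rLab b = 1), ← sum_prod_ite s t (fun a => s.bLab a = 0) (fun b => t.bLab b = 0),
    ← sum_prod_ite s t (fun a => s.rLab a = 0 ∧ s.bLab a = 0) (fun b => t.rLab b = 0 ∧ t.bLab b = 0),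
    ← sum_prod_ite s t (fun a => s.rLab a = 1 ∧ s.bLab a = 0) (fun b => t.rLab b = 0 ∧ t.bLab b = 0),
    ← sum_prod_ite s t (fun a => s.rLab a = 0 ∧ s.bLab a = 0) (fun b => t.rLab b = 1 ∧ t.bLab b = 0),
    ← Fintype.card_prod, ← Finset.card_univ, Finset.card_eq_sum_ones]
  change (∑ y : s.Conf × t.Conf, if 2 ≤ s.rLab y.1 + t.rLab y.2 ∧ 1 ≤ s.bLab y.1 + t.bLab y.2 then 1 else 0) + _ + _ + _ + _
    = _ + _ + _ + _
  rw [← Finset.sum_add_distrib, ← Finset.sum_add_distrib, ← Finset.sum_add_distrib, ← Finset.sum_add_distrib,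
    ← Finset.sum_add_distrib, ← Finset.sum_add_distrib, ← Finset.sum_add_distrib]
  refine Finset.sum_congr rfl (fun y _ => ?_)
  split_ifs <;> omega

end Product

/-- **three edge-disjoint red paths are rarer than two edge-disjoint red paths together with a blue
path**, on every pattern of the grammar: `#{r ≥ 3} ≤ #{r ≥ 2 ∧ b ≥ 1}` -/
theorem disjoint3_le_conn2 : ∀ s : V2Closure.SP,
    (Finset.univ.filter (fun y : s.Conf => 3 ≤ s.rLab y)).card
      ≤ (Finset.univ.filter (fun y : s.Conf => 2 ≤ s.rLab y ∧ 1 ≤ s.bLab y)).card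
  | .free => by decide
  | .pin => by decide
  | .absent => by decide
  | .ser s t => by
    rw [card_r3_ser, card_c2_ser]
    exact Nat.mul_le_mul (disjoint3_le_conn2 s) (disjoint3_le_conn2 t)
  | .par s t => by
    have hs := disjoint3_le_conn2 s
    have ht := disjoint3_le_conn2 t
    have e1 := card_r3_par s t
    have e2 := card_c2_par s t
    have a1 := card_r3_add s
    have a2 := card_r3_add t
    have b1 := card_c2_add s
    have b2 := card_c2_add t
    have z1 := card_zw_le s
    have z2 := card_zw_le t
    have w1 := card_w_le s
    have w2 := card_w_le t
    rw [card_b0_eq_r0 s] at e2 b1 z1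
    rw [card_b0_eq_r0 t] at e2 b2 z2
    set D := (Finset.univ.filter (fun y : (V2Closure.SP.par s t).Conf => 3 ≤ (V2Closure.SP.par s t).rLab y)).card
    set C := (Finset.univ.filter (fun y : (V2Closure.SP.par s t).Conf =>
      2 ≤ (V2Closure.SP.par s t).rLab y ∧ 1 ≤ (V2Closure.SP.par s t).bLab y)).card
    set Ds := (Finset.univ.filter (fun y : s.Conf => 3 ≤ s.rLab y)).card
    set Dt := (Finset.univ.filter (fun y : t.Conf => 3 ≤ t.rLab y)).card
    set Cs := (Finset.univ.filter (fun y : s.Conf => 2 ≤ s.rLab y ∧ 1 ≤ s.bLab y)).card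
    set Ct := (Finset.univ.filter (fun y : t.Conf => 2 ≤ t.rLab y ∧ 1 ≤ t.bLab y)).card
    set P := (Finset.univ.filter (fun y : s.Conf => s.rLab y = 0)).card
    set P' := (Finset.univ.filter (fun y : t.Conf => t.rLab y = 0)).card
    set Q := (Finset.univ.filter (fun y : s.Conf => s.rLab y = 1)).card
    set Q' := (Finset.univ.filter (fun y : t.Conf => t.rLab y = 1)).card
    set Q₂ := (Finset.univ.filter (fun y : s.Conf => s.rLab y = 2)).card
    set Q₂' := (Finset.univ.filter (fun y : t.Conf => t.rLab y = 2)).card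
    set Z := (Finset.univ.filter (fun y : s.Conf => s.rLab y = 0 ∧ s.bLab y = 0)).card
    set Z' := (Finset.univ.filter (fun y : t.Conf => t.rLab y = 0 ∧ t.bLab y = 0)).card
    set W := (Finset.univ.filter (fun y : s.Conf => s.rLab y = 1 ∧ s.bLab y = 0)).card
    set W' := (Finset.univ.filter (fun y : t.Conf => t.rLab y = 1 ∧ t.bLab y = 0)).card
    set M := Fintype.card s.Conf
    set M' := Fintype.card t.Conf
    -- the induction hypotheses in the dual form `P ≤ Q₂ + Z + W`
    have hq : (P : ℤ) ≤ Q₂ + Z + W := by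
      have h1 : (Ds : ℤ) ≤ Cs := by exact_mod_cast hs
      have h2 : (Ds : ℤ) + P + Q + Q₂ = M := by exact_mod_cast a1
      have h3 : (Cs : ℤ) + P + Q + P = M + Z + W := by exact_mod_cast b1
      linarith
    have hq' : (P' : ℤ) ≤ Q₂' + Z' + W' := by
      have h1 : (Dt : ℤ) ≤ Ct := by exact_mod_cast ht
      have h2 : (Dt : ℤ) + P' + Q' + Q₂' = M' := by exact_mod_cast a2
      have h3 : (Ct : ℤ) + P' + Q' + P' = M' + Z' + W' := by exact_mod_cast b2
      linarith
    have hzw : (Z : ℤ) + W ≤ P := by exact_mod_cast z1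
    have hzw' : (Z' : ℤ) + W' ≤ P' := by exact_mod_cast z2
    have hw : (W : ℤ) ≤ Q := by exact_mod_cast w1
    have hw' : (W' : ℤ) ≤ Q' := by exact_mod_cast w2
    have k1 : (P : ℤ) * P' ≤ (Q₂ + Z + W) * P' := mul_le_mul_of_nonneg_right hq (by positivity)
    have k2 : ((Z : ℤ) + W) * P' ≤ (Z + W) * (Q₂' + Z' + W') := mul_le_mul_of_nonneg_left hq' (by positivity)
    have k3 : ((Z : ℤ) + W) * Q₂' ≤ P * Q₂' := mul_le_mul_of_nonneg_right hzw (by positivity)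
    have k4 : (W : ℤ) * W' ≤ Q * Q' := mul_le_mul hw hw' (by positivity) (by positivity)
    have key : (P : ℤ) * P' ≤ Q₂ * P' + Q * Q' + P * Q₂' + Z * Z' + W * Z' + Z * W' := by nlinarith [k1, k2, k3, k4]
    have e1' : (D : ℤ) + P * P' + Q * P' + P * Q' + Q₂ * P' + Q * Q' + P * Q₂' = M * M' := by exact_mod_cast e1
    have e2' : (C : ℤ) + P * P' + Q * P' + P * Q' + P * P' = M * M' + Z * Z' + W * Z' + Z * W' := by exact_mod_cast e2
    have : (D : ℤ) ≤ C := by linarith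
    exact_mod_cast this

/-- the same in the vocabulary of `Tail2DP2Series`: `stat s (3 ≤ r) ≤ stat s (2 ≤ r ∧ 1 ≤ b)` -/
theorem stat_disjoint3_le_conn2 (s : V2Closure.SP) :
    stat s (fun r _ => 3 ≤ r) ≤ stat s (fun r b => 2 ≤ r ∧ 1 ≤ b) :=
  disjoint3_le_conn2 s

end Summit.Ventures.PercRepro2.Tail2D
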